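import Summits.BirchSwinnertonDyer.BirchSwinnertonDyer.Theorems.ResidualThetaTransportAtTwoResidualSignedLambdaLowerCMAtTwoPlusValueWellDefined
import Literature.NumberTheory.EllipticCurves.GreenbergSelmerDualDataExistsProofs
import Literature.NumberTheory.EllipticCurves.Kobayashi2003.SignedSelmer
import Literature.NumberTheory.EllipticCurves.SharpFlatPAdicLFunctionCoeffField
import Mathlib.Algebra.Module.CharacterModule
import HarnessLib

/-!
# S2 core: the plus Kummer pairing `pair₂ : Hom((E(ℚ_{∞,v}))ʳ, ℤ_p) → Sg⋆` of the one-pair duality road — EXISTS, pin-free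
# (helper toward crux RSL_g `ResidualSignedLambdaLowerCMAtTwo`, stmt-BirchSwinnertonDyer-22608; `--supports`, closes nothing)

Route `ResidualThetaTransportAtTwo` (RTT); seat `prover-bsd-wall-rtt-p2` g17 (lead of line `onepair`). THEOREMS ONLY. BSD is not proved by any
of this; RSL_g stays OPEN. This is the pin-free core of the registered stub S2 `stub_plusColemanO` of `Cruxes/ResidualSignedLambdaLowerCMAtTwo/
Lines/onepair.lean` (v2c): for a Selmer-type subgroup `Sg ≤ H¹(Γ_∞, A_ρ)` all of whose classes have a PLUS Kummer datum at the place `v`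
(through the transport `Θ : A_ρ ≃ E[p^∞]ʳ`), the map

  `pair₂ t s := (t(p^k Q) mod p^k) · p^{-k} ∈ ℚ/ℤ`,  `(φ, Q, k)` any Kummer datum of `s` with `p^k Q ∈ E(ℚ_{∞,v})ʳ`,

is well defined (`PlusValue.levelValue_eq_of_kummerData`, p688548), biadditive, `ℤ_p`-balanced against the `𝒪`-structure of `Sg`
(`pair₂ (c • t) s = pair₂ t (ι(c) • s)`, the scalar datum `[ι(c) φ] = scalarH1 ι(c) [φ]`), takes the registered VALUE on every Kummer datum,
and kills every `t` whose coordinates lie in the kernel of the plus Coleman map (`col z = 0 ↔ z` vanishes on all `E⁺(ℚ_{n,v})`).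

* `iSup_signedLocalPoints_le_localTowerPointsOfEmb`, `exists_pow_smul_cofree_eq_zero`, `exists_pow_smul_cocycle_eq_zero` (compactness of `Γ_∞`),
  `coeff_smul_eq_nsmul_of_pow_smul_eq_zero` (`ι(c) • a = N • a` on `p^E`-torsion, `N = c mod p^E`), `apply_eq_zero_of_mem_iSup_signedLocalPoints`.
* **`exists_plusPair`** — the three clauses (LIN) ∧ (VAL) ∧ (KER) of `stub_plusColemanO`, for general `p`, abstract `Θ`, abstract `col`.

References: [Kobayashi2003] Thm 8.2, (8.23) (p. 18); [PerrinRiou1994Invent] §3.6.1; [MilneADT2006] Ch. I §6; [SilvermanAEC2009] VIII §2.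
-/

set_option autoImplicit false
-- the Theorems namespace of this sub repeats the summit name by design (D-0017 nested layout)
set_option linter.dupNamespace false

noncomputable section

open scoped Classical

namespace Summit.BirchSwinnertonDyer.BirchSwinnertonDyer.Theorems.PlusValue

open NumberField Field IsDedekindDomain WeierstrassCurve Literature.NumberTheory.EllipticCurves
  Literature.NumberTheory.EllipticCurves.GreenbergSelmer Literature.NumberTheory.GaloisRepresentations
  Literature.NumberTheory.EllipticCurves.Kobayashi2003 Literature.NumberTheory.EllipticCurves.Sprung2012

variable {p : ℕ} [Fact p.Prime] {S : Set (PadicAlgCl p)} {d : ℕ} {ρ : FramedGaloisRep ℚ ↥(padicCoeffIntegers S) d}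
  (W : WeierstrassCurve ℚ) {r : ℕ} (Θ : Cofree ρ ↥(padicCoeffField S) ≃+ (Fin r → ↥(W.geomPrimaryTorsion p)))
  (κ : ZpExtension ℚ p) (v : HeightOneSpectrum (𝓞 ℚ))

/-- `⨆_n E⁺(ℚ_{n,v}) ≤ E(ℚ_{∞,v})`. [cite: Kobayashi2003, Def. 1.1] -/
theorem iSup_signedLocalPoints_le_localTowerPointsOfEmb :
    (⨆ m : ℕ, signedLocalPoints κ (v.adicCompletion ℚ) W 1 m) ≤ localTowerPointsOfEmb κ (closureEmb (K := ℚ) (v.adicCompletion ℚ)) W :=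
  iSup_le fun m ↦ (signedLocalPointsOfEmb_le κ _ W 1 m).trans (localLayerPointsOfEmb_le_localTowerPointsOfEmb κ _ W m)

include W Θ in
/-- Every element of the cofree module `A_ρ ≃ E[p^∞]ʳ` is killed by a power of `p` (read through `Θ`). [cite: SilvermanAEC2009, III §7] -/
theorem exists_pow_smul_cofree_eq_zero (a : Cofree ρ ↥(padicCoeffField S)) : ∃ e : ℕ, (p ^ e) • a = 0 := by
  obtain ⟨e, he⟩ := exists_pow_smul_theta_eq_zero W Θ a
  refine ⟨e, Θ.map_eq_zero_iff.mp ?_⟩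
  rw [map_nsmul]
  funext i
  apply Subtype.ext
  rw [Pi.smul_apply, AddSubgroupClass.coe_nsmul, he i]
  rfl

include W Θ in
/-- A continuous cocycle on the COMPACT group `Γ_∞ = ker κ` with values in the discrete torsion module `A_ρ` has finitely many values, hence is
killed by one power of `p`. [cite: SerreGaloisCohomology1997, I §2.2] -/
theorem exists_pow_smul_cocycle_eq_zero (φ : contOneCocycles (discreteTopRep ↥κ.kerSubgroup (Cofree ρ ↥(padicCoeffField S)))) :
    ∃ E : ℕ, ∀ g : ↥κ.kerSubgroup, (p ^ E) • φ.1 g = 0 := by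
  haveI : CompactSpace ↥κ.kerSubgroup := isCompact_iff_compactSpace.mp κ.isClosed_kerSubgroup.isCompact
  have hfin : (Set.range (φ.1 : ↥κ.kerSubgroup → Cofree ρ ↥(padicCoeffField S))).Finite :=
    (isCompact_range φ.1.continuous).finite_of_discrete
  choose e he using fun a : Cofree ρ ↥(padicCoeffField S) ↦ exists_pow_smul_cofree_eq_zero W Θ a
  refine ⟨hfin.toFinset.sup e, fun g ↦ ?_⟩
  obtain ⟨c, hc⟩ := Nat.exists_eq_add_of_le (Finset.le_sup (f := e) (hfin.mem_toFinset.mpr ⟨g, rfl⟩))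
  rw [hc, pow_add, mul_comm, mul_smul, he, smul_zero]

/-- On a `p^E`-torsion element the coefficient scalar `ι(c)`, `c ∈ ℤ_p`, acts as the integer `N = (c mod p^E)`. [folklore] -/
theorem coeff_smul_eq_nsmul_of_pow_smul_eq_zero (c : ℤ_[p]) (a : Cofree ρ ↥(padicCoeffField S)) (E : ℕ) (ha : (p ^ E) • a = 0) :
    padicIntToCoeffIntegers S c • a = (PadicInt.toZModPow E c).val • a := by
  obtain ⟨y, hy⟩ := Ideal.mem_span_singleton'.mp (ErratumThm23TwoVariable.TwistedPeriodic.sub_val_toZModPow_mem E c)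
  have hc : c = ((PadicInt.toZModPow E c).val : ℤ_[p]) + y * (p : ℤ_[p]) ^ E := by rw [hy]; ring
  rw [hc, map_add, map_natCast, map_mul, map_pow, map_natCast, add_smul, Nat.cast_smul_eq_nsmul, mul_smul, ← Nat.cast_pow,
    Nat.cast_smul_eq_nsmul, ha, smul_zero, add_zero]
  -- the right-hand side: `toZModPow E` of the rewritten `c` is unchanged
  congr 2
  rw [← hc]

/-- `c • y ≡ N • y (mod p^k)` for `N = c mod p^(E+k)`. [folklore] -/
theorem toZModPow_smul_eq_toZModPow_nsmul (k E : ℕ) (c y : ℤ_[p]) :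
    PadicInt.toZModPow k (c • y) = PadicInt.toZModPow k ((PadicInt.toZModPow (E + k) c).val • y) := by
  have hsub : c - ((PadicInt.toZModPow (E + k) c).val : ℤ_[p]) ∈ Ideal.span {(p : ℤ_[p]) ^ k} :=
    Ideal.span_singleton_le_span_singleton.mpr (pow_dvd_pow (p : ℤ_[p]) (Nat.le_add_left k E))
      (ErratumThm23TwoVariable.TwistedPeriodic.sub_val_toZModPow_mem (E + k) c)
  rw [← PadicInt.ker_toZModPow, RingHom.mem_ker, map_sub, sub_eq_zero] at hsub
  rw [smul_eq_mul, nsmul_eq_mul, map_mul, map_mul, hsub]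

/-- The level value of `0` vanishes. [folklore] -/
theorem levelValue_zero (k : ℕ) :
    ((PadicInt.toZModPow k (0 : ℤ_[p])).val • ((((p : ℚ) ^ k)⁻¹ : ℚ) : AddCircle (1 : ℚ)) : AddCircle (1 : ℚ)) = 0 := by
  rw [(PadicInt.toZModPow k).map_zero, ZMod.val_zero, zero_smul]

/-- An additive functional on the tower points vanishing on every `E⁺(ℚ_{n,v})` vanishes on `⨆_n E⁺(ℚ_{n,v})`. [cite: Kobayashi2003, Def. 1.1] -/
theorem apply_eq_zero_of_mem_iSup_signedLocalPoints
    (z : ↥(localTowerPointsOfEmb κ (closureEmb (K := ℚ) (v.adicCompletion ℚ)) W) →+ ℤ_[p])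
    (hz : ∀ (m : ℕ) (x : localPoints W (v.adicCompletion ℚ)) (hx : x ∈ signedLocalPoints κ (v.adicCompletion ℚ) W 1 m),
      z ⟨x, localLayerPointsOfEmb_le_localTowerPointsOfEmb κ _ W m (signedLocalPointsOfEmb_le κ _ W 1 m hx)⟩ = 0)
    {x : localPoints W (v.adicCompletion ℚ)} (hx : x ∈ ⨆ m : ℕ, signedLocalPoints κ (v.adicCompletion ℚ) W 1 m)
    (hxT : x ∈ localTowerPointsOfEmb κ (closureEmb (K := ℚ) (v.adicCompletion ℚ)) W) : z ⟨x, hxT⟩ = 0 := by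
  have key : ∃ h : x ∈ localTowerPointsOfEmb κ (closureEmb (K := ℚ) (v.adicCompletion ℚ)) W, z ⟨x, h⟩ = 0 := by
    refine AddSubgroup.iSup_induction (fun m : ℕ ↦ signedLocalPoints κ (v.adicCompletion ℚ) W 1 m)
      (C := fun y ↦ ∃ h : y ∈ localTowerPointsOfEmb κ (closureEmb (K := ℚ) (v.adicCompletion ℚ)) W, z ⟨y, h⟩ = 0) hx
      (fun m y hy ↦ ⟨_, hz m y hy⟩) ⟨zero_mem _, map_zero z⟩ ?_
    rintro y y' ⟨hy, hzy⟩ ⟨hy', hzy'⟩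
    refine ⟨add_mem hy hy', ?_⟩
    have : (⟨y + y', add_mem hy hy'⟩ : ↥(localTowerPointsOfEmb κ (closureEmb (K := ℚ) (v.adicCompletion ℚ)) W)) = ⟨y, hy⟩ + ⟨y', hy'⟩ := rfl
    rw [this, map_add, hzy, hzy', add_zero]
  obtain ⟨_, h⟩ := key
  exact h

set_option maxHeartbeats 400000 in
/-- **S2 core — the plus Kummer pairing exists.** For `Sg ≤ H¹(Γ_∞, A_ρ)` with its `𝒪`-structure `hsmul` and a PLUS Kummer datum at `v`
for every class (`hex`), and any map `col` on `Hom(E(ℚ_{∞,v}), ℤ_p)` whose kernel is the set of functionals vanishing on all `E⁺(ℚ_{n,v})`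
(`hker`, the Coleman pin), there is `pair₂ : Hom(E(ℚ_{∞,v})ʳ, ℤ_p) →+ Sg⋆` with
(LIN) `pair₂ (c • t) s = pair₂ t (ι(c) • s)`; (VAL) `pair₂ t s = (t(p^kQ) mod p^k)·p^{-k}` on EVERY Kummer datum `(φ, Q, k)` of `s` with
`p^k Q ∈ E(ℚ_{∞,v})ʳ`; (KER) `pair₂ t = 0` whenever every coordinate `t ∘ single i` lies in `ker col`.
[cite: Kobayashi2003, Thm 8.2, (8.23) (p. 18)] [cite: PerrinRiou1994Invent, §3.6.1] [cite: MilneADT2006, Ch. I §6] -/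
theorem exists_plusPair
    (hΘ : ∀ (δ : absoluteGaloisGroup (v.adicCompletion ℚ)) (m : Cofree ρ ↥(padicCoeffField S)) (i : Fin r),
      Θ (resGalOfEmb (closureEmb (K := ℚ) (v.adicCompletion ℚ)) δ • m) i =
        resGalOfEmb (closureEmb (K := ℚ) (v.adicCompletion ℚ)) δ • Θ m i)
    (Sg : AddSubgroup (subgroupH1 κ.kerSubgroup (Cofree ρ ↥(padicCoeffField S))))
    [Module ↥(padicCoeffIntegers S) ↥Sg]
    (hsmul : ∀ (a : ↥(padicCoeffIntegers S)) (s : ↥Sg),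
      ((a • s : ↥Sg) : subgroupH1 κ.kerSubgroup (Cofree ρ ↥(padicCoeffField S))) =
        scalarH1 κ.kerSubgroup (Cofree ρ ↥(padicCoeffField S)) a s)
    (hex : ∀ s : ↥Sg, ∃ (φ : contOneCocycles (discreteTopRep ↥κ.kerSubgroup (Cofree ρ ↥(padicCoeffField S))))
      (Q : Fin r → localPoints W (v.adicCompletion ℚ)) (k : ℕ),
      oneCocycleClass (discreteTopRep ↥κ.kerSubgroup (Cofree ρ ↥(padicCoeffField S))) φ =
          (s : subgroupH1 κ.kerSubgroup (Cofree ρ ↥(padicCoeffField S))) ∧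
        (∀ i, (p ^ k) • Q i ∈ ⨆ m : ℕ, signedLocalPoints κ (v.adicCompletion ℚ) W 1 m) ∧
        ∀ (τ : ↥(localSubgroupOfEmb κ.kerSubgroup (closureEmb (K := ℚ) (v.adicCompletion ℚ)))) (i : Fin r),
          pointsMapOfEmb W (closureEmb (K := ℚ) (v.adicCompletion ℚ))
            ((Θ (φ.1 (resGalSubgroupOfEmb κ.kerSubgroup (closureEmb (K := ℚ) (v.adicCompletion ℚ)) τ)) i : ↥(W.geomPrimaryTorsion p)) :
              W.geomPoints) = (τ : absoluteGaloisGroup (v.adicCompletion ℚ)) • Q i - Q i)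
    (col : (↥(localTowerPointsOfEmb κ (closureEmb (K := ℚ) (v.adicCompletion ℚ)) W) →+ ℤ_[p]) →ₗ[ℤ_[p]] PowerSeries ℤ_[p])
    (hker : ∀ z : ↥(localTowerPointsOfEmb κ (closureEmb (K := ℚ) (v.adicCompletion ℚ)) W) →+ ℤ_[p],
      col z = 0 ↔ ∀ (m : ℕ) (x : localPoints W (v.adicCompletion ℚ)) (hx : x ∈ signedLocalPoints κ (v.adicCompletion ℚ) W 1 m),
        z ⟨x, localLayerPointsOfEmb_le_localTowerPointsOfEmb κ _ W m (signedLocalPointsOfEmb_le κ _ W 1 m hx)⟩ = 0) :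
    ∃ pair₂ : ((Fin r → ↥(localTowerPointsOfEmb κ (closureEmb (K := ℚ) (v.adicCompletion ℚ)) W)) →+ ℤ_[p]) →+ CharacterModule ↥Sg,
      (∀ (c : ℤ_[p]) (t : (Fin r → ↥(localTowerPointsOfEmb κ (closureEmb (K := ℚ) (v.adicCompletion ℚ)) W)) →+ ℤ_[p]) (s : ↥Sg),
        pair₂ (c • t) s = pair₂ t (padicIntToCoeffIntegers S c • s)) ∧
      (∀ (t : (Fin r → ↥(localTowerPointsOfEmb κ (closureEmb (K := ℚ) (v.adicCompletion ℚ)) W)) →+ ℤ_[p]) (s : ↥Sg)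
        (φ : contOneCocycles (discreteTopRep ↥κ.kerSubgroup (Cofree ρ ↥(padicCoeffField S))))
        (Q : Fin r → localPoints W (v.adicCompletion ℚ)) (k : ℕ)
        (hQ : ∀ i, (p ^ k) • Q i ∈ localTowerPointsOfEmb κ (closureEmb (K := ℚ) (v.adicCompletion ℚ)) W),
        oneCocycleClass (discreteTopRep ↥κ.kerSubgroup (Cofree ρ ↥(padicCoeffField S))) φ =
            (s : subgroupH1 κ.kerSubgroup (Cofree ρ ↥(padicCoeffField S))) →
          (∀ (τ : ↥(localSubgroupOfEmb κ.kerSubgroup (closureEmb (K := ℚ) (v.adicCompletion ℚ)))) (i : Fin r),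
            pointsMapOfEmb W (closureEmb (K := ℚ) (v.adicCompletion ℚ))
              ((Θ (φ.1 (resGalSubgroupOfEmb κ.kerSubgroup (closureEmb (K := ℚ) (v.adicCompletion ℚ)) τ)) i : ↥(W.geomPrimaryTorsion p)) :
                W.geomPoints) = (τ : absoluteGaloisGroup (v.adicCompletion ℚ)) • Q i - Q i) →
          pair₂ t s = (PadicInt.toZModPow k (t (fun i => ⟨(p ^ k) • Q i, hQ i⟩))).val • ((((p : ℚ) ^ k)⁻¹ : ℚ) : AddCircle (1 : ℚ))) ∧
      (∀ t : (Fin r → ↥(localTowerPointsOfEmb κ (closureEmb (K := ℚ) (v.adicCompletion ℚ)) W)) →+ ℤ_[p],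
        (∀ i : Fin r, col (t.comp (AddMonoidHom.single (fun _ : Fin r => ↥(localTowerPointsOfEmb κ (closureEmb (K := ℚ) (v.adicCompletion ℚ)) W)) i)) = 0) →
          pair₂ t = 0) := by
  -- the chosen Kummer data
  choose φ Q k hcl hplus hkum using hex
  have hQT : ∀ (s : ↥Sg) (i : Fin r), (p ^ k s) • Q s i ∈ localTowerPointsOfEmb κ (closureEmb (K := ℚ) (v.adicCompletion ℚ)) W :=
    fun s i ↦ iSup_signedLocalPoints_le_localTowerPointsOfEmb W κ v (hplus s i)
  -- the value on the chosen datum, and its independence of the datum (p688548)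
  have hval : ∀ (t : (Fin r → ↥(localTowerPointsOfEmb κ (closureEmb (K := ℚ) (v.adicCompletion ℚ)) W)) →+ ℤ_[p]) (s : ↥Sg)
      (φ' : contOneCocycles (discreteTopRep ↥κ.kerSubgroup (Cofree ρ ↥(padicCoeffField S))))
      (Q' : Fin r → localPoints W (v.adicCompletion ℚ)) (k' : ℕ)
      (hQ' : ∀ i, (p ^ k') • Q' i ∈ localTowerPointsOfEmb κ (closureEmb (K := ℚ) (v.adicCompletion ℚ)) W),
      oneCocycleClass (discreteTopRep ↥κ.kerSubgroup (Cofree ρ ↥(padicCoeffField S))) φ' =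
          (s : subgroupH1 κ.kerSubgroup (Cofree ρ ↥(padicCoeffField S))) →
        (∀ (τ : ↥(localSubgroupOfEmb κ.kerSubgroup (closureEmb (K := ℚ) (v.adicCompletion ℚ)))) (i : Fin r),
          pointsMapOfEmb W (closureEmb (K := ℚ) (v.adicCompletion ℚ))
            ((Θ (φ'.1 (resGalSubgroupOfEmb κ.kerSubgroup (closureEmb (K := ℚ) (v.adicCompletion ℚ)) τ)) i : ↥(W.geomPrimaryTorsion p)) :
              W.geomPoints) = (τ : absoluteGaloisGroup (v.adicCompletion ℚ)) • Q' i - Q' i) →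
        ((PadicInt.toZModPow (k s) (t (fun i ↦ ⟨(p ^ k s) • Q s i, hQT s i⟩))).val • ((((p : ℚ) ^ k s)⁻¹ : ℚ) : AddCircle (1 : ℚ)) :
            AddCircle (1 : ℚ)) =
          (PadicInt.toZModPow k' (t (fun i ↦ ⟨(p ^ k') • Q' i, hQ' i⟩))).val • ((((p : ℚ) ^ k')⁻¹ : ℚ) : AddCircle (1 : ℚ)) :=
    fun t s φ' Q' k' hQ' hφ' hK' ↦
      levelValue_eq_of_kummerData W Θ κ v hΘ t (φ s) φ' (by rw [hcl s, hφ']) (Q s) Q' (k s) k' (hQT s) hQ' (hkum s) hK'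
  -- additivity in `s`: the sum datum `(φ_s + φ_{s'}, Q_s + Q_{s'}, k_s + k_{s'})`
  have hadd_s : ∀ (t : (Fin r → ↥(localTowerPointsOfEmb κ (closureEmb (K := ℚ) (v.adicCompletion ℚ)) W)) →+ ℤ_[p]) (s s' : ↥Sg),
      ((PadicInt.toZModPow (k (s + s')) (t (fun i ↦ ⟨(p ^ k (s + s')) • Q (s + s') i, hQT (s + s') i⟩))).val •
          ((((p : ℚ) ^ k (s + s'))⁻¹ : ℚ) : AddCircle (1 : ℚ)) : AddCircle (1 : ℚ)) =
        (PadicInt.toZModPow (k s) (t (fun i ↦ ⟨(p ^ k s) • Q s i, hQT s i⟩))).val • ((((p : ℚ) ^ k s)⁻¹ : ℚ) : AddCircle (1 : ℚ)) +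
          (PadicInt.toZModPow (k s') (t (fun i ↦ ⟨(p ^ k s') • Q s' i, hQT s' i⟩))).val • ((((p : ℚ) ^ k s')⁻¹ : ℚ) : AddCircle (1 : ℚ)) := by
    intro t s s'
    have hQQ : ∀ i, (p ^ (k s + k s')) • (Q s i + Q s' i) ∈ localTowerPointsOfEmb κ (closureEmb (K := ℚ) (v.adicCompletion ℚ)) W := by
      intro i
      rw [smul_add]
      refine add_mem ?_ ?_
      · rw [pow_add, mul_comm, mul_smul]
        exact AddSubgroup.nsmul_mem _ (hQT s i) _
      · rw [pow_add, mul_smul]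
        exact AddSubgroup.nsmul_mem _ (hQT s' i) _
    have hK : ∀ (τ : ↥(localSubgroupOfEmb κ.kerSubgroup (closureEmb (K := ℚ) (v.adicCompletion ℚ)))) (i : Fin r),
        pointsMapOfEmb W (closureEmb (K := ℚ) (v.adicCompletion ℚ))
          ((Θ ((φ s + φ s').1 (resGalSubgroupOfEmb κ.kerSubgroup (closureEmb (K := ℚ) (v.adicCompletion ℚ)) τ)) i :
            ↥(W.geomPrimaryTorsion p)) : W.geomPoints) =
          (τ : absoluteGaloisGroup (v.adicCompletion ℚ)) • (Q s i + Q s' i) - (Q s i + Q s' i) := by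
      intro τ i
      rw [Submodule.coe_add, ContinuousMap.add_apply, map_add, Pi.add_apply, AddMemClass.coe_add, map_add, hkum s τ i,
        hkum s' τ i, smul_add]
      abel
    rw [hval t (s + s') (φ s + φ s') (fun i ↦ Q s i + Q s' i) (k s + k s') hQQ (by rw [oneCocycleClass_add, hcl s, hcl s']; rfl) hK]
    have hid : (fun i ↦ (⟨(p ^ (k s + k s')) • (Q s i + Q s' i), hQQ i⟩ : ↥(localTowerPointsOfEmb κ (closureEmb (K := ℚ) (v.adicCompletion ℚ)) W))) =
        (p ^ k s') • (fun i ↦ (⟨(p ^ k s) • Q s i, hQT s i⟩ : ↥(localTowerPointsOfEmb κ (closureEmb (K := ℚ) (v.adicCompletion ℚ)) W))) +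
          (p ^ k s) • (fun i ↦ (⟨(p ^ k s') • Q s' i, hQT s' i⟩ : ↥(localTowerPointsOfEmb κ (closureEmb (K := ℚ) (v.adicCompletion ℚ)) W))) := by
      funext i
      apply Subtype.ext
      simp only [Pi.add_apply, Pi.smul_apply, AddMemClass.coe_add, AddSubgroupClass.coe_nsmul]
      rw [smul_add, smul_smul, smul_smul, ← pow_add, ← pow_add, add_comm (k s') (k s)]
    rw [hid, map_add, map_nsmul, map_nsmul, nsmul_eq_mul, nsmul_eq_mul, Nat.cast_pow, Nat.cast_pow, levelValue_add,
      levelValue_mul_pow]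
    have h2 := levelValue_mul_pow (p := p) (k s') (k s) (t (fun i ↦ ⟨(p ^ k s') • Q s' i, hQT s' i⟩))
    rw [add_comm (k s') (k s)] at h2
    rw [h2]
  -- additivity in `t`
  have hadd_t : ∀ (t t' : (Fin r → ↥(localTowerPointsOfEmb κ (closureEmb (K := ℚ) (v.adicCompletion ℚ)) W)) →+ ℤ_[p]) (s : ↥Sg),
      ((PadicInt.toZModPow (k s) ((t + t') (fun i ↦ ⟨(p ^ k s) • Q s i, hQT s i⟩))).val • ((((p : ℚ) ^ k s)⁻¹ : ℚ) : AddCircle (1 : ℚ)) :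
          AddCircle (1 : ℚ)) =
        (PadicInt.toZModPow (k s) (t (fun i ↦ ⟨(p ^ k s) • Q s i, hQT s i⟩))).val • ((((p : ℚ) ^ k s)⁻¹ : ℚ) : AddCircle (1 : ℚ)) +
          (PadicInt.toZModPow (k s) (t' (fun i ↦ ⟨(p ^ k s) • Q s i, hQT s i⟩))).val • ((((p : ℚ) ^ k s)⁻¹ : ℚ) : AddCircle (1 : ℚ)) := by
    intro t t' s
    rw [AddMonoidHom.add_apply]
    exact levelValue_add (k s) _ _
  -- the map, with its evaluation rule
  have hP : ∃ pair₂ : ((Fin r → ↥(localTowerPointsOfEmb κ (closureEmb (K := ℚ) (v.adicCompletion ℚ)) W)) →+ ℤ_[p]) →+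
      CharacterModule ↥Sg, ∀ (t : (Fin r → ↥(localTowerPointsOfEmb κ (closureEmb (K := ℚ) (v.adicCompletion ℚ)) W)) →+ ℤ_[p]) (s : ↥Sg),
      pair₂ t s = ((PadicInt.toZModPow (k s) (t (fun i ↦ ⟨(p ^ k s) • Q s i, hQT s i⟩))).val • ((((p : ℚ) ^ k s)⁻¹ : ℚ) : AddCircle (1 : ℚ)) :
        AddCircle (1 : ℚ)) :=
    ⟨AddMonoidHom.mk' (fun t ↦ (AddMonoidHom.mk'
        (fun s : ↥Sg ↦ ((PadicInt.toZModPow (k s) (t (fun i ↦ ⟨(p ^ k s) • Q s i, hQT s i⟩))).val •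
          ((((p : ℚ) ^ k s)⁻¹ : ℚ) : AddCircle (1 : ℚ)) : AddCircle (1 : ℚ))) (hadd_s t) : CharacterModule ↥Sg))
      (fun t t' ↦ DFunLike.ext _ _ fun s ↦ hadd_t t t' s), fun _ _ ↦ rfl⟩
  refine hP.elim fun pair₂ hpair₂ ↦ ?_
  refine ⟨pair₂, ?_, ?_, ?_⟩
  · -- (LIN): the scalar datum `(ι(c) φ_s, N • Q_s, k_s)`, `N = c mod p^(E + k_s)`
    intro c t s
    rw [hpair₂, hpair₂, AddMonoidHom.smul_apply]
    refine (exists_pow_smul_cocycle_eq_zero W Θ κ (φ s)).elim fun E hE ↦ ?_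
    have hE' : ∀ g, (p ^ (E + k s)) • (φ s).1 g = 0 := fun g ↦ by rw [pow_add, mul_comm, mul_smul, hE g, smul_zero]
    have hφcex : ∃ φc : contOneCocycles (discreteTopRep ↥κ.kerSubgroup (Cofree ρ ↥(padicCoeffField S))),
        oneCocycleClass _ φc = scalarH1 κ.kerSubgroup (Cofree ρ ↥(padicCoeffField S)) (padicIntToCoeffIntegers S c) (oneCocycleClass _ (φ s)) ∧
          ∀ g, φc.1 g = padicIntToCoeffIntegers S c • (φ s).1 g :=
      ⟨_, (scalarH1_oneCocycleClass κ.kerSubgroup (Cofree ρ ↥(padicCoeffField S)) (padicIntToCoeffIntegers S c) (φ s)).symm, fun _ ↦ rfl⟩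
    refine hφcex.elim fun φc hφc' ↦ ?_
    have hφc := hφc'.1
    have hφcv := hφc'.2
    have hQc : ∀ i, (p ^ k s) • ((PadicInt.toZModPow (E + k s) c).val • Q s i) ∈
        localTowerPointsOfEmb κ (closureEmb (K := ℚ) (v.adicCompletion ℚ)) W := fun i ↦ by
      rw [smul_comm]
      exact AddSubgroup.nsmul_mem _ (hQT s i) _
    have hKc : ∀ (τ : ↥(localSubgroupOfEmb κ.kerSubgroup (closureEmb (K := ℚ) (v.adicCompletion ℚ)))) (i : Fin r),
        pointsMapOfEmb W (closureEmb (K := ℚ) (v.adicCompletion ℚ))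
          ((Θ (φc.1 (resGalSubgroupOfEmb κ.kerSubgroup (closureEmb (K := ℚ) (v.adicCompletion ℚ)) τ)) i : ↥(W.geomPrimaryTorsion p)) :
            W.geomPoints) =
          (τ : absoluteGaloisGroup (v.adicCompletion ℚ)) • ((PadicInt.toZModPow (E + k s) c).val • Q s i) -
            (PadicInt.toZModPow (E + k s) c).val • Q s i := by
      intro τ i
      rw [hφcv, coeff_smul_eq_nsmul_of_pow_smul_eq_zero c _ (E + k s) (hE' _), map_nsmul, Pi.smul_apply, AddSubgroupClass.coe_nsmul,
        map_nsmul, hkum s τ i, smul_sub, smul_comm]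
    have hcl' : oneCocycleClass _ φc = ((padicIntToCoeffIntegers S c • s : ↥Sg) : subgroupH1 κ.kerSubgroup (Cofree ρ ↥(padicCoeffField S))) := by
      rw [hφc, hcl s, hsmul]
    rw [hval t (padicIntToCoeffIntegers S c • s) φc _ (k s) hQc hcl' hKc]
    have hid : (fun i ↦ (⟨(p ^ k s) • ((PadicInt.toZModPow (E + k s) c).val • Q s i), hQc i⟩ :
        ↥(localTowerPointsOfEmb κ (closureEmb (K := ℚ) (v.adicCompletion ℚ)) W))) =
        (PadicInt.toZModPow (E + k s) c).val • (fun i ↦ (⟨(p ^ k s) • Q s i, hQT s i⟩ : ↥(localTowerPointsOfEmb κ (closureEmb (K := ℚ) (v.adicCompletion ℚ)) W))) := by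
      funext i
      apply Subtype.ext
      simp only [Pi.smul_apply, AddSubgroupClass.coe_nsmul]
      rw [smul_comm]
    rw [hid, map_nsmul]
    exact levelValue_eq_of_toZModPow_eq (k s) (toZModPow_smul_eq_toZModPow_nsmul (k s) E c _)
  · -- (VAL)
    intro t s φ' Q' k' hQ' hφ' hK'
    rw [hpair₂]
    exact hval t s φ' Q' k' hQ' hφ' hK'
  · -- (KER): evaluate on the chosen PLUS datum; every coordinate of `t` dies on `⨆_n E⁺(ℚ_{n,v})`
    intro t ht
    refine DFunLike.ext _ _ fun s ↦ ?_
    refine (hpair₂ t s).trans ?_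
    have h0 : t (fun i ↦ ⟨(p ^ k s) • Q s i, hQT s i⟩) = 0 := by
      rw [← Finset.univ_sum_single (fun i ↦ (⟨(p ^ k s) • Q s i, hQT s i⟩ : ↥(localTowerPointsOfEmb κ (closureEmb (K := ℚ) (v.adicCompletion ℚ)) W))),
        map_sum]
      refine Finset.sum_eq_zero fun i _ ↦ ?_
      have := apply_eq_zero_of_mem_iSup_signedLocalPoints W κ v
        (t.comp (AddMonoidHom.single (fun _ : Fin r => ↥(localTowerPointsOfEmb κ (closureEmb (K := ℚ) (v.adicCompletion ℚ)) W)) i))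
        ((hker _).mp (ht i)) (hplus s i) (hQT s i)
      rwa [AddMonoidHom.comp_apply, AddMonoidHom.single_apply] at this
    rw [h0, levelValue_zero]
    rfl

end Summit.BirchSwinnertonDyer.BirchSwinnertonDyer.Theorems.PlusValue

end
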